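import Mathlib
import HarnessLib
import Literature.MathematicalPhysics.QuantumFieldTheory.Balaban1983to89.B13PkOrderEdges
import Summits.QuantumFields.BalabanUV.Beta.LinearizingChange267Jet

/-!
# [Balaban1987RG1] (2.5) p. 266: the cubic remainder `G₃` of the gauge-fixing term — *«an analytic function of B′, with an
# expansion beginning with third order terms, localized in blocks»* — DERIVED, in abstract kernel form, from the STRUCTURE of
# the gauge-fixing term (cell topic `Summits/QuantumFields/BalabanUV/Beta/GaugeFixingCubic266`)

HONEST FRAMING (cell rule).  Discharging `BetaPertH` makes Bałaban's UV stability UNCONDITIONAL — a real constructive-QFT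
result; NOT the continuum limit, NOT the Clay problem.  This module discharges NOTHING of `BetaPertH`: it supplies, as folklore
complex analysis in Banach spaces with explicit constants, the `G₃`-clause of cell GAPS G-adv9-20 column (a) — terminal leaf
(T4)(a) of the row-D4 apex map `BETA/REMAINDER-BETA.md` §9 («analyticity radii of G₃, D̃, V by reference»; the `G₃` item is
classed «definitional-adjacent, LOW» there).  Bookkeeping-grade; NOT summit progress.  Unit `b2b-balaban-beta-an4-g32`.

CITATION HEADER (lean-in-tree rule).  [I] = T. Bałaban, *Renormalization group approach to lattice gauge field theories. I.
Generation of effective actions in a small field approximation and a coupling constant renormalization in four dimensions*,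
Commun. Math. Phys. **109**, 249–301 (1987) [Balaban1987RG1] (PDF page = journal page − 248).  Read as images by this seat
(renders `HOME/b2b-balaban-ref1/pages/1987-cmp109-rg-I-small-field/…-p006-x2.png`, `…-p007-x2.png`, `…-p018-x2.png`), verbatim:
* p. 254 (0.14): *«Instead we introduce exponential gauge fixing functions, exp[−(1/2α)|U(y,x) − 1|²] = exp[−(1/α)[1 − Re tr U(y,x)]].
  (0.14)»*;
* p. 255 (0.19): the gauge-fixing term of the k-th step *«−(1/g_k²) Σ_{y∈T^{(k+1)}} Σ_{x∈B(y),x≠y} [1 − Re tr U(y,x)]»*;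
* p. 266: *«The gauge fixing term under the exponential in (2.1) is equal to G(V′V^{(k)}) = G̃(V′) = G(B′). The variables
  Ṽ′(y,x) = (V′V^{(k)})(y,x)(V^{(k)}(y,x))⁻¹ have an expansion of the form Ṽ′(y,x) = 1 + B̃′(y,x) + …, where B̃′(y,x) is a
  linear function, hence the gauge fixing expression has the representation
  G(B′) = Σ_{y∈T^{(k+1)}} Σ_{x∈B(y),x≠y} ½|B̃′(y,x)|² + G₃(B′) = ½G⁽²⁾(B′) + G₃(B′). (2.5)
  The function G₃(B′) is an analytic function of B′, with an expansion beginning with third order terms, localized in blocks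
  of the lattice T^{(k)}.»*;
* p. 268 (2.12): the term *«− (1/g_k²)G₃(g_kB)»* of the exponent (the census' T4-type term).

WHAT IS REPRODUCED, AND HOW (abstract form; the dictionary is NOT claimed).  The printed gauge-fixing term is a FINITE SUM over
the pairs `i = (y,x)` of ONE scalar potential `φ` (print: `U ↦ 1 − Re tr U` in the chart `U = e^{iX}`, so `φ(0) = 0` AND `Dφ(0) = 0`)
composed with block variables `X_i(B′)` (print: the Lie-algebra coordinate of `Ṽ′(y,x)`, analytic near `0`, `X_i(0) = 0`, linear part
`B̃′(y,x) = DX_i(0)B′`).  For ANY such data (`structure Chart`, a HYPOTHESIS bundle) this file DEFINES `gTot = Σ_i φ ∘ X_i` (print's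
`G(B′)`), `gQuad = Σ_i φ^{(2)} ∘ DX_i(0)` (print's `½G⁽²⁾ = ΣΣ ½|B̃′|²`; `φ^{(2)} = homPart φ 2 = ½D²φ(0)(·,·)` of `B13ExpansionOrder`),
`gCubic = gTot − gQuad` (print's `G₃`, EXACTLY as (2.5) defines it) and PROVES: §2 `gTot` analytic, `gTot 0 = 0`, `fderiv ℂ gTot 0 = 0`
(chain rule through the critical point of `φ`); §3 THE CUBIC ESTIMATE `‖gCubic B‖ ≤ cubicConst·‖B‖³` with an explicit constant
(per block: the order-3 Cauchy remainder of `φ` at `X_iB = O(‖B‖)`, plus the quadratic form `φ^{(2)}` at two points `O(‖B‖²)` apart —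
two nested Cauchy estimates, `B13Ineq140.norm_d2_le_of_bound`); §4 *«analytic … beginning with third order terms»*:
`analyticOnNhd_gCubic`, **`beginsAt_gCubic_three : BeginsAt gCubic 3`**, and THE IDENTIFICATION the print makes by writing `½G⁽²⁾`
for the quadratic part, **`homPart_gTot_two : homPart gTot 2 = gQuad`**, hence `gCubic = rem gTot 2`; §5 *«localized in blocks»*:
`gCubic = Σ_i gCubicTerm i`, each term depending on `B′` only through its block (`gCubicTerm_local`); §6 THE T4 EDGE OF THE
(2.12)-CENSUS BY NAME with its three `G₃`-hypotheses (analyticity, cubic bound, radius) DISCHARGED: `quadraticForm_scaled_gCubic`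
(`B13PkScaling.quadraticForm_of_scaled_cubic`).  The concrete potential of (0.14)/(0.19), `X ↦ τ1 − ½τ(e^{iX} + e^{−iX})`, is left to a
companion module; here `φ` is abstract.

NOT CLAIMED (the dictionary; cell DIVERGENCE row for this file).  That Bałaban's `Ṽ′(y,x)(B′)` — the averaged contour variable
(0.11)/(0.12) of `V′V^{(k)}` times `(V^{(k)}(y,x))⁻¹` — has a Lie-algebra coordinate `X_{yx}(B′)` ANALYTIC on a `B′`-polydisc of radius
uniform in `k` and the volume, vanishing at `B′ = 0` (a B7-level statement about the averaging operation, by reference in print); that the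
printed `|·|²` on 𝔤 is the quadratic part of `1 − Re tr exp(i·)`; the identification of the index set with `{(y,x) : x ∈ B(y), x ≠ y}` and of
«blocks» with the supports of the `X_{yx}`; sup-norm polydiscs vs. the balls used here.  Nothing about Bałaban's `β`-functions is asserted;
the one `structure … : Prop` (`Chart`) is a parameterised HYPOTHESIS bundle, inhabited (`chart_witness`), asserted nowhere.
PRIOR ART IN THE TREE (searched 2026-08-20; nothing re-derived): `B13ExpansionOrder` (`BeginsAt`, `homPart`, `rem`, Cauchy bounds),
`B13PkOrderEdges` (`homPart_two_eq_fderiv_fderiv`), `B13PkScaling` (`quadraticForm_of_scaled_cubic`, `d2_eq_fderiv_fderiv`),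
`B13Ineq140` (`norm_d2_le_of_bound`), `LinearizingChange267Jet` (`homPart_two_smul`) — all BY NAME; all of them take `G₃`'s
analyticity / onset order / bounds as HYPOTHESES («by reference to the print», C-B13-25/28/29).  `Beta.GaugeFixing`,
`Beta.GaugeTermBackground`, `Beta.MultiplierSector` quote (2.5) as CONTEXT for the QUADRATIC part only.  No module derives the `G₃`-clause.
-/

open Metric Set Filter Topology
open Literature.MathematicalPhysics.QuantumFieldTheory.Balaban1983to89
open B11SchwarzRemainder (OrderGe)
open B13ExpansionOrder (slice BeginsAt homPart rem beginsAt_one beginsAt_two norm_le_of_beginsAt norm_homPart_le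
  norm_rem_le homPart_one homPart_zero_right homPart_eq_of_orderGe_sub eq_zero_of_beginsAt_succ)
open B13PkOrderEdges (homPart_two_eq_fderiv_fderiv analyticOnNhd_homPart_two nonneg_of_bound)
open B13PkScaling (Qop scaled quadraticForm_of_scaled_cubic d2_eq_fderiv_fderiv)
open Summit.QuantumFields.BalabanUV.Beta.LinearizingChange267Jet (homPart_two_smul)

namespace Summit.QuantumFields.BalabanUV.Beta.GaugeFixingCubic266

noncomputable section

variable {E V : Type*} [NormedAddCommGroup E] [NormedSpace ℂ E] [NormedAddCommGroup V] [NormedSpace ℂ V]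
variable {ι : Type*}

/-! ## §1. The objects of (2.5): `G(B′) = Σ φ(X_{yx}(B′))`, `½G⁽²⁾(B′) = Σ φ^{(2)}(B̃′(y,x))`, `G₃ = G − ½G⁽²⁾` -/

/-- The gauge-fixing expression in the chart, `G(B′) = Σ_{(y,x)} φ(X_{yx}(B′))`: the (0.19) sum `ΣΣ [1 − Re tr U(y,x)]` as ONE
potential `φ` composed with the block variables. [cite: Balaban1987RG1, (2.5) p.266] -/
def gTot [Fintype ι] (φ : V → ℂ) (X : ι → E → V) (B : E) : ℂ := ∑ i, φ (X i B)

/-- The linear part `B̃′(y,x) = DX_{yx}(0)` (*«where B̃′(y,x) is a linear function»*). [cite: Balaban1987RG1, p.266] -/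
def linPart (X : ι → E → V) (i : ι) : E →L[ℂ] V := fderiv ℂ (X i) 0

/-- The quadratic form `½G⁽²⁾(B′) = ΣΣ ½|B̃′(y,x)|²`, `½|·|²` read as the quadratic part `φ^{(2)} = homPart φ 2 = ½D²φ(0)(·,·)` of
the potential. [cite: Balaban1987RG1, (2.5) p.266] -/
def gQuad [Fintype ι] (φ : V → ℂ) (X : ι → E → V) (B : E) : ℂ := ∑ i, homPart φ 2 (linPart X i B)

/-- One block's contribution to `G₃`: `φ(X_{yx}(B′)) − φ^{(2)}(B̃′(y,x))`. [cite: Balaban1987RG1, (2.5) p.266] -/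
def gCubicTerm (φ : V → ℂ) (X : ι → E → V) (i : ι) (B : E) : ℂ := φ (X i B) - homPart φ 2 (linPart X i B)

/-- `G₃(B′) := G(B′) − ½G⁽²⁾(B′)`, exactly as (2.5) defines it. [cite: Balaban1987RG1, (2.5) p.266] -/
def gCubic [Fintype ι] (φ : V → ℂ) (X : ι → E → V) (B : E) : ℂ := gTot φ X B - gQuad φ X B

/-- `G₃ = Σ_{(y,x)} [φ(X_{yx}) − φ^{(2)}(B̃′(y,x))]` — the blockwise form. [folklore] -/
theorem gCubic_eq_sum [Fintype ι] (φ : V → ℂ) (X : ι → E → V) (B : E) :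
    gCubic φ X B = ∑ i, gCubicTerm φ X i B := by
  simp only [gCubic, gTot, gQuad, gCubicTerm, Finset.sum_sub_distrib]

/-- THE ABSTRACT DATA of (2.5): a potential `φ` analytic and bounded on `ball 0 Rφ` with VANISHING 1-JET at `0` (print:
`1 − Re tr e^{iX}`: value `0` and no linear term at `X = 0`), and block variables `X_i` analytic and bounded by `MX < Rφ` on
`ball 0 RX` with `X_i(0) = 0` (print: the coordinate of `Ṽ′(y,x)`, `= 1` at `B′ = 0`).  All four numbers are free parameters
(the print's radii are by reference to [Balaban1985Averaging]); a HYPOTHESIS bundle — nothing printed is asserted. [folklore] -/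
structure Chart (φ : V → ℂ) (X : ι → E → V) (Rφ Mφ RX MX : ℝ) : Prop where
  Rφ_pos : 0 < Rφ
  RX_pos : 0 < RX
  φ_an : AnalyticOnNhd ℂ φ (ball 0 Rφ)
  φ_bd : ∀ v ∈ ball (0 : V) Rφ, ‖φ v‖ ≤ Mφ
  φ_zero : φ 0 = 0
  φ_crit : fderiv ℂ φ 0 = 0
  X_an : ∀ i, AnalyticOnNhd ℂ (X i) (ball 0 RX)
  X_bd : ∀ i, ∀ B ∈ ball (0 : E) RX, ‖X i B‖ ≤ MX
  X_zero : ∀ i, X i 0 = 0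
  MX_lt : MX < Rφ

/-- The explicit cubic constant of §3: `|ι| · 2MφMX²(MX + 9Rφ)/(Rφ³RX³)`. [folklore] -/
def cubicConst (Rφ Mφ RX MX : ℝ) (n : ℕ) : ℝ := n * (2 * Mφ * MX ^ 2 * (MX + 9 * Rφ) / (Rφ ^ 3 * RX ^ 3))

variable {φ : V → ℂ} {X : ι → E → V} {Rφ Mφ RX MX : ℝ}

/-! ## §2. `G`: analytic, `G(0) = 0`, `DG(0) = 0` — the gauge-fixing expression begins with quadratic terms -/

namespace Chart

/-- `0 ≤ Mφ`. [folklore] -/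
theorem Mφ_nonneg (h : Chart φ X Rφ Mφ RX MX) : 0 ≤ Mφ := nonneg_of_bound h.Rφ_pos h.φ_bd

/-- `0 ≤ MX` (some block exists). [folklore] -/
theorem MX_nonneg [Nonempty ι] (h : Chart φ X Rφ Mφ RX MX) : 0 ≤ MX :=
  nonneg_of_bound h.RX_pos (h.X_bd (Classical.arbitrary ι))

/-- `BeginsAt φ 2`: the potential has no constant and no linear term. [folklore] -/
theorem beginsAt_φ (h : Chart φ X Rφ Mφ RX MX) : BeginsAt φ 2 :=
  beginsAt_two h.Rφ_pos h.φ_an.differentiableOn h.φ_zero h.φ_crit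

/-- `BeginsAt X_i 1`: the block variables vanish at `B′ = 0`. [folklore] -/
theorem beginsAt_X [CompleteSpace V] (h : Chart φ X Rφ Mφ RX MX) (i : ι) : BeginsAt (X i) 1 :=
  beginsAt_one h.RX_pos (h.X_an i).differentiableOn (h.X_zero i)

/-- Schwarz: `‖X_i(B)‖ ≤ MX·‖B‖/RX` on the ball. [folklore] -/
theorem norm_X_le [CompleteSpace V] (h : Chart φ X Rφ Mφ RX MX) (i : ι) {B : E} (hB : B ∈ ball (0 : E) RX) :
    ‖X i B‖ ≤ MX * (‖B‖ / RX) := by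
  simpa using norm_le_of_beginsAt (h.X_an i).differentiableOn (h.X_bd i) (h.beginsAt_X i) hB

/-- The block variables land in the potential's ball. [folklore] -/
theorem X_mem (h : Chart φ X Rφ Mφ RX MX) (i : ι) {B : E} (hB : B ∈ ball (0 : E) RX) : X i B ∈ ball (0 : V) Rφ :=
  mem_ball_zero_iff.2 ((h.X_bd i B hB).trans_lt h.MX_lt)

/-- Cauchy: `‖B̃′(y,x)‖ = ‖DX_i(0)B‖ ≤ MX·‖B‖/RX` on the ball. [folklore] -/
theorem norm_linPart_le [CompleteSpace V] (h : Chart φ X Rφ Mφ RX MX) (i : ι) {B : E} (hB : B ∈ ball (0 : E) RX) :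
    ‖linPart X i B‖ ≤ MX * (‖B‖ / RX) := by
  have hd : DifferentiableAt ℂ (X i) 0 := ((h.X_an i) 0 (mem_ball_self h.RX_pos)).differentiableAt
  simpa [linPart, homPart_one hd] using norm_homPart_le (h.X_an i).differentiableOn (h.X_bd i) (h.beginsAt_X i) hB

/-- The order-2 remainder of a block variable: `‖X_i(B) − B̃′_i(B)‖ ≤ 2MX(‖B‖/RX)²`. [folklore] -/
theorem norm_X_sub_linPart_le [CompleteSpace V] (h : Chart φ X Rφ Mφ RX MX) (i : ι) {B : E} (hB : B ∈ ball (0 : E) RX) :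
    ‖X i B - linPart X i B‖ ≤ 2 * MX * (‖B‖ / RX) ^ 2 := by
  have hd : DifferentiableAt ℂ (X i) 0 := ((h.X_an i) 0 (mem_ball_self h.RX_pos)).differentiableAt
  simpa [linPart, rem, homPart_one hd] using norm_rem_le (h.X_an i).differentiableOn (h.X_bd i) (h.beginsAt_X i) hB

/-- Each summand `φ ∘ X_i` is analytic on the ball. [folklore] -/
theorem analyticOnNhd_comp (h : Chart φ X Rφ Mφ RX MX) (i : ι) : AnalyticOnNhd ℂ (fun B => φ (X i B)) (ball 0 RX) :=
  fun B hB => (h.φ_an _ (h.X_mem i hB)).comp ((h.X_an i) B hB)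

/-- `G` is analytic on the ball. [cite: Balaban1987RG1, (2.5) p.266] -/
theorem analyticOnNhd_gTot [Fintype ι] (h : Chart φ X Rφ Mφ RX MX) : AnalyticOnNhd ℂ (gTot φ X) (ball 0 RX) := by
  have : gTot φ X = fun B => ∑ i ∈ Finset.univ, φ (X i B) := rfl
  rw [this]
  exact Finset.analyticOnNhd_fun_sum _ fun i _ => h.analyticOnNhd_comp i

/-- `G(0) = 0` (print: `G(V^{(k)}) = 0`, the axial gauge conditions, so `G̃(1) = 0`). [folklore] -/
theorem gTot_zero [Fintype ι] (h : Chart φ X Rφ Mφ RX MX) : gTot φ X 0 = 0 := by simp [gTot, h.X_zero, h.φ_zero]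

/-- Each summand has derivative `0` at `B′ = 0`: chain rule through the critical point of `φ`. [folklore] -/
theorem hasFDerivAt_comp_zero (h : Chart φ X Rφ Mφ RX MX) (i : ι) :
    HasFDerivAt (fun B => φ (X i B)) (0 : E →L[ℂ] ℂ) 0 := by
  have hX : HasFDerivAt (X i) (linPart X i) 0 :=
    (((h.X_an i) 0 (mem_ball_self h.RX_pos)).differentiableAt).hasFDerivAt
  have hφ : HasFDerivAt φ (fderiv ℂ φ 0) (X i 0) := by
    rw [h.X_zero i]
    exact ((h.φ_an 0 (mem_ball_self h.Rφ_pos)).differentiableAt).hasFDerivAt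
  have hc := hφ.comp 0 hX
  rwa [h.φ_crit, ContinuousLinearMap.zero_comp] at hc

/-- `DG(0) = 0`. [folklore] -/
theorem fderiv_gTot_zero [Fintype ι] (h : Chart φ X Rφ Mφ RX MX) : fderiv ℂ (gTot φ X) 0 = 0 := by
  have hs : HasFDerivAt (fun B => ∑ i ∈ Finset.univ, φ (X i B)) (∑ i ∈ (Finset.univ : Finset ι), (0 : E →L[ℂ] ℂ)) 0 :=
    HasFDerivAt.fun_sum fun i _ => h.hasFDerivAt_comp_zero i
  rw [Finset.sum_const_zero] at hs
  exact hs.fderiv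

/-- `G` begins with quadratic terms. [folklore] -/
theorem beginsAt_gTot_two [Fintype ι] (h : Chart φ X Rφ Mφ RX MX) : BeginsAt (gTot φ X) 2 :=
  beginsAt_two h.RX_pos h.analyticOnNhd_gTot.differentiableOn h.gTot_zero h.fderiv_gTot_zero

/-- A sup bound for `G` on the ball: `|ι|·Mφ`. [folklore] -/
theorem norm_gTot_le [Fintype ι] (h : Chart φ X Rφ Mφ RX MX) {B : E} (hB : B ∈ ball (0 : E) RX) :
    ‖gTot φ X B‖ ≤ Fintype.card ι * Mφ := by
  calc ‖gTot φ X B‖ ≤ ∑ i, ‖φ (X i B)‖ := norm_sum_le _ _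
    _ ≤ ∑ _i : ι, Mφ := Finset.sum_le_sum fun i _ => h.φ_bd _ (h.X_mem i hB)
    _ = Fintype.card ι * Mφ := by simp

/-! ## §3. The cubic estimate with an explicit constant -/

/-- Two nested Cauchy estimates: `‖D²φ(0)(u, v)‖ ≤ (9Mφ/Rφ²)‖u‖‖v‖` (shells `Rφ/3 < 2Rφ/3 < Rφ`,
`B13Ineq140.norm_d2_le_of_bound`). [folklore] -/
theorem norm_d2φ_le (h : Chart φ X Rφ Mφ RX MX) (u v : V) :
    ‖fderiv ℂ (fderiv ℂ φ) 0 u v‖ ≤ 9 * Mφ / Rφ ^ 2 * ‖u‖ * ‖v‖ := by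
  have hR := h.Rφ_pos
  have hB : ∀ z : V, ‖z‖ ≤ 2 * Rφ / 3 → ‖φ z‖ ≤ Mφ := fun z hz => h.φ_bd z (mem_ball_zero_iff.2 (by linarith))
  have h2 := B13Ineq140.norm_d2_le_of_bound (ρ₀ := 0) (ρ₁ := Rφ / 3) (ρ₂ := 2 * Rφ / 3) h.φ_an (by linarith)
    (by linarith) (by linarith) hB (p := 0) (by simp) u v
  rw [d2_eq_fderiv_fderiv h.φ_an isOpen_ball (mem_ball_self hR)] at h2
  rw [show 2 * Rφ / 3 - Rφ / 3 = Rφ / 3 by ring, show Rφ / 3 - 0 = Rφ / 3 by ring, div_div,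
    show Rφ / 3 * (Rφ / 3) = Rφ ^ 2 / 9 by ring, div_div_eq_mul_div, show Mφ * 9 / Rφ ^ 2 = 9 * Mφ / Rφ ^ 2 by ring] at h2
  exact h2

/-- The quadratic part of the potential is the quadratic form `½D²φ(0)(w,w)`. [folklore] -/
theorem homPart_φ_eq (h : Chart φ X Rφ Mφ RX MX) (w : V) :
    homPart φ 2 w = (2 : ℂ)⁻¹ * fderiv ℂ (fderiv ℂ φ) 0 w w := by
  rw [homPart_two_eq_fderiv_fderiv h.Rφ_pos h.φ_an w, smul_eq_mul]

/-- Differences of the quadratic part: `‖φ^{(2)}(u) − φ^{(2)}(u′)‖ ≤ ½(9Mφ/Rφ²)‖u − u′‖(‖u‖ + ‖u′‖)`. [folklore] -/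
theorem norm_homPart_sub_le (h : Chart φ X Rφ Mφ RX MX) (u u' : V) :
    ‖homPart φ 2 u - homPart φ 2 u'‖ ≤ 1 / 2 * (9 * Mφ / Rφ ^ 2) * ‖u - u'‖ * (‖u‖ + ‖u'‖) := by
  set Q := fderiv ℂ (fderiv ℂ φ) 0 with hQ
  have hid : Q u u - Q u' u' = Q (u - u') u + Q u' (u - u') := by
    simp only [map_sub, sub_apply]
    ring
  rw [h.homPart_φ_eq, h.homPart_φ_eq, ← mul_sub, hid, norm_mul, norm_inv, Complex.norm_ofNat]
  have h1 := h.norm_d2φ_le (u - u') u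
  have h2 := h.norm_d2φ_le u' (u - u')
  calc 2⁻¹ * ‖Q (u - u') u + Q u' (u - u')‖ ≤ 2⁻¹ * (‖Q (u - u') u‖ + ‖Q u' (u - u')‖) :=
        mul_le_mul_of_nonneg_left (norm_add_le _ _) (by norm_num)
    _ ≤ 2⁻¹ * (9 * Mφ / Rφ ^ 2 * ‖u - u'‖ * ‖u‖ + 9 * Mφ / Rφ ^ 2 * ‖u'‖ * ‖u - u'‖) :=
        mul_le_mul_of_nonneg_left (add_le_add h1 h2) (by norm_num)
    _ = 1 / 2 * (9 * Mφ / Rφ ^ 2) * ‖u - u'‖ * (‖u‖ + ‖u'‖) := by ring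

/-- **Per-block cubic estimate** `‖φ(X_i B) − φ^{(2)}(B̃′_i B)‖ ≤ [2MφMX²(MX + 9Rφ)/(Rφ³RX³)]·‖B‖³` on the ball: the order-3 Cauchy
remainder of `φ` at `X_iB = O(‖B‖)` plus the quadratic form at two points `O(‖B‖²)` apart. [folklore] -/
theorem norm_gCubicTerm_le [CompleteSpace V] [Nonempty ι] (h : Chart φ X Rφ Mφ RX MX) (i : ι) {B : E} (hB : B ∈ ball (0 : E) RX) :
    ‖gCubicTerm φ X i B‖ ≤ 2 * Mφ * MX ^ 2 * (MX + 9 * Rφ) / (Rφ ^ 3 * RX ^ 3) * ‖B‖ ^ 3 := by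
  have hRφ := h.Rφ_pos; have hRX := h.RX_pos; have hMφ := h.Mφ_nonneg; have hMX := h.MX_nonneg
  set v := X i B with hv
  set w := linPart X i B with hw
  have hvmem : v ∈ ball (0 : V) Rφ := h.X_mem i hB
  have hv1 : ‖v‖ ≤ MX * (‖B‖ / RX) := h.norm_X_le i hB
  have hw1 : ‖w‖ ≤ MX * (‖B‖ / RX) := h.norm_linPart_le i hB
  have hvw : ‖v - w‖ ≤ 2 * MX * (‖B‖ / RX) ^ 2 := h.norm_X_sub_linPart_le i hB
  have hsplit : gCubicTerm φ X i B = rem φ 2 v + (homPart φ 2 v - homPart φ 2 w) := by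
    simp only [gCubicTerm, rem, ← hv, ← hw]
    ring
  have hA : ‖rem φ 2 v‖ ≤ 2 * Mφ * (‖v‖ / Rφ) ^ 3 := norm_rem_le h.φ_an.differentiableOn h.φ_bd h.beginsAt_φ hvmem
  have hA' : ‖rem φ 2 v‖ ≤ 2 * Mφ * (MX * (‖B‖ / RX) / Rφ) ^ 3 := by
    refine hA.trans (mul_le_mul_of_nonneg_left ?_ (by positivity))
    exact pow_le_pow_left₀ (by positivity) (div_le_div_of_nonneg_right hv1 hRφ.le) 3
  have hB' : ‖homPart φ 2 v - homPart φ 2 w‖ ≤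
      1 / 2 * (9 * Mφ / Rφ ^ 2) * (2 * MX * (‖B‖ / RX) ^ 2) * (2 * (MX * (‖B‖ / RX))) := by
    refine (h.norm_homPart_sub_le v w).trans ?_
    have h9 : 0 ≤ 1 / 2 * (9 * Mφ / Rφ ^ 2) := by positivity
    calc 1 / 2 * (9 * Mφ / Rφ ^ 2) * ‖v - w‖ * (‖v‖ + ‖w‖)
        ≤ 1 / 2 * (9 * Mφ / Rφ ^ 2) * (2 * MX * (‖B‖ / RX) ^ 2) * (‖v‖ + ‖w‖) :=
          mul_le_mul_of_nonneg_right (mul_le_mul_of_nonneg_left hvw h9) (by positivity)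
      _ ≤ 1 / 2 * (9 * Mφ / Rφ ^ 2) * (2 * MX * (‖B‖ / RX) ^ 2) * (2 * (MX * (‖B‖ / RX))) :=
          mul_le_mul_of_nonneg_left (by linarith) (by positivity)
  calc ‖gCubicTerm φ X i B‖ = ‖rem φ 2 v + (homPart φ 2 v - homPart φ 2 w)‖ := by rw [hsplit]
    _ ≤ ‖rem φ 2 v‖ + ‖homPart φ 2 v - homPart φ 2 w‖ := norm_add_le _ _
    _ ≤ 2 * Mφ * (MX * (‖B‖ / RX) / Rφ) ^ 3 +
        1 / 2 * (9 * Mφ / Rφ ^ 2) * (2 * MX * (‖B‖ / RX) ^ 2) * (2 * (MX * (‖B‖ / RX))) := add_le_add hA' hB'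
    _ = 2 * Mφ * MX ^ 2 * (MX + 9 * Rφ) / (Rφ ^ 3 * RX ^ 3) * ‖B‖ ^ 3 := by
        have hRφ' : Rφ ≠ 0 := hRφ.ne'; have hRX' : RX ≠ 0 := hRX.ne'
        field_simp

/-- **THE CUBIC ESTIMATE** `‖G₃(B′)‖ ≤ cubicConst·‖B′‖³` on the ball — the quantitative form of *«an expansion beginning with
third order terms»* with an explicit constant (the hypothesis shape `‖P z‖ ≤ K‖z‖³` of the (2.12)-census,
`B13PkScaling.quadraticForm_of_scaled_cubic`). [cite: Balaban1987RG1, (2.5) p.266] -/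
theorem norm_gCubic_le [CompleteSpace V] [Fintype ι] (h : Chart φ X Rφ Mφ RX MX) {B : E} (hB : B ∈ ball (0 : E) RX) :
    ‖gCubic φ X B‖ ≤ cubicConst Rφ Mφ RX MX (Fintype.card ι) * ‖B‖ ^ 3 := by
  rcases isEmpty_or_nonempty ι with hι | hι
  · simp [gCubic_eq_sum, cubicConst]
  rw [gCubic_eq_sum, cubicConst]
  calc ‖∑ i, gCubicTerm φ X i B‖ ≤ ∑ i, ‖gCubicTerm φ X i B‖ := norm_sum_le _ _
    _ ≤ ∑ _i : ι, 2 * Mφ * MX ^ 2 * (MX + 9 * Rφ) / (Rφ ^ 3 * RX ^ 3) * ‖B‖ ^ 3 :=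
        Finset.sum_le_sum fun i _ => h.norm_gCubicTerm_le i hB
    _ = Fintype.card ι * (2 * Mφ * MX ^ 2 * (MX + 9 * Rφ) / (Rφ ^ 3 * RX ^ 3)) * ‖B‖ ^ 3 := by
        simp [Finset.sum_const, mul_assoc]

/-- `0 ≤ cubicConst`. [folklore] -/
theorem cubicConst_nonneg [Fintype ι] [Nonempty ι] (h : Chart φ X Rφ Mφ RX MX) : 0 ≤ cubicConst Rφ Mφ RX MX (Fintype.card ι) := by
  have := h.Mφ_nonneg; have := h.MX_nonneg; have := h.Rφ_pos; have := h.RX_pos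
  unfold cubicConst; positivity

/-! ## §4. *«an analytic function of B′, with an expansion beginning with third order terms»*, and `G₃ = rem G 2` -/

/-- The quadratic form `½G⁽²⁾` is analytic on the whole space (a continuous quadratic form composed with the `B̃′_i`). [folklore] -/
theorem analyticOnNhd_gQuad [Fintype ι] (h : Chart φ X Rφ Mφ RX MX) : AnalyticOnNhd ℂ (gQuad φ X) univ := by
  have : gQuad φ X = fun B => ∑ i ∈ Finset.univ, homPart φ 2 (linPart X i B) := rfl
  rw [this]
  refine Finset.analyticOnNhd_fun_sum _ fun i _ => fun B _ => ?_
  exact (analyticOnNhd_homPart_two h.Rφ_pos h.φ_an _ (mem_univ _)).comp ((linPart X i).analyticAt B)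

/-- `G₃` is analytic on the ball. [cite: Balaban1987RG1, (2.5) p.266] -/
theorem analyticOnNhd_gCubic [Fintype ι] (h : Chart φ X Rφ Mφ RX MX) : AnalyticOnNhd ℂ (gCubic φ X) (ball 0 RX) :=
  fun B hB => (h.analyticOnNhd_gTot B hB).sub (h.analyticOnNhd_gQuad B (mem_univ _))

/-- `½G⁽²⁾(0) = 0`. [folklore] -/
theorem gQuad_zero [Fintype ι] (h : Chart φ X Rφ Mφ RX MX) : gQuad φ X 0 = 0 := by simp [gQuad, homPart_zero_right h.φ_zero 1]

/-- `G₃(0) = 0`. [folklore] -/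
theorem gCubic_zero [Fintype ι] (h : Chart φ X Rφ Mφ RX MX) : gCubic φ X 0 = 0 := by rw [gCubic, h.gTot_zero, h.gQuad_zero, sub_zero]

/-- **`BeginsAt G₃ 3`** — *«with an expansion beginning with third order terms»*, in the typed reading of
`B13ExpansionOrder.BeginsAt` (every complex slice is `O(t³)`), from the cubic estimate. [cite: Balaban1987RG1, (2.5) p.266] -/
theorem beginsAt_gCubic_three [CompleteSpace V] [Fintype ι] (h : Chart φ X Rφ Mφ RX MX) : BeginsAt (gCubic φ X) 3 := by
  intro w
  by_cases hw : w = 0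
  · subst hw
    refine OrderGe.of_bound_on_ball one_pos (C := 0) fun t _ => ?_
    simp [slice, h.gCubic_zero]
  · have hr : 0 < RX / ‖w‖ := div_pos h.RX_pos (norm_pos_iff.2 hw)
    refine OrderGe.of_bound_on_ball hr (C := cubicConst Rφ Mφ RX MX (Fintype.card ι) * ‖w‖ ^ 3) fun t ht => ?_
    have hmem : t • w ∈ ball (0 : E) RX := B13ExpansionOrder.smul_mem_ball hw ht
    calc ‖slice (gCubic φ X) w t‖ = ‖gCubic φ X (t • w)‖ := rfl
      _ ≤ cubicConst Rφ Mφ RX MX (Fintype.card ι) * ‖t • w‖ ^ 3 := h.norm_gCubic_le hmem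
      _ = cubicConst Rφ Mφ RX MX (Fintype.card ι) * ‖w‖ ^ 3 * ‖t‖ ^ 3 := by rw [norm_smul]; ring

/-- Homogeneity of the quadratic form: `½G⁽²⁾(t•B′) = t²·½G⁽²⁾(B′)`. [folklore] -/
theorem gQuad_smul [Fintype ι] (h : Chart φ X Rφ Mφ RX MX) (t : ℂ) (w : E) : gQuad φ X (t • w) = t ^ 2 * gQuad φ X w := by
  simp only [gQuad, map_smul, Finset.mul_sum]
  exact Finset.sum_congr rfl fun i _ => by rw [homPart_two_smul h.Rφ_pos h.φ_an, smul_eq_mul]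

/-- **THE IDENTIFICATION BEHIND `½G⁽²⁾`**: the order-2 homogeneous part of the gauge-fixing expression `G` IS the printed
quadratic form `ΣΣ ½|B̃′(y,x)|²` — `homPart G 2 = gQuad` (uniqueness of the quadratic Taylor term along each complex line,
`B13ExpansionOrder.homPart_eq_of_orderGe_sub`, fed with `BeginsAt G₃ 3`). [cite: Balaban1987RG1, (2.5) p.266] -/
theorem homPart_gTot_two [CompleteSpace V] [Fintype ι] (h : Chart φ X Rφ Mφ RX MX) (w : E) : homPart (gTot φ X) 2 w = gQuad φ X w := by
  by_cases hw : w = 0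
  · subst hw
    rw [homPart_zero_right h.gTot_zero 1, h.gQuad_zero]
  · refine homPart_eq_of_orderGe_sub h.RX_pos h.analyticOnNhd_gTot.differentiableOn (fun B hB => h.norm_gTot_le hB)
      h.beginsAt_gTot_two hw ?_
    have h3 := h.beginsAt_gCubic_three w
    refine (B11SchwarzRemainder.orderGe_iff_isBigO.1 h3).congr' (Eventually.of_forall fun t => ?_) EventuallyEq.rfl
      |> B11SchwarzRemainder.orderGe_iff_isBigO.2
    show slice (gCubic φ X) w t = gTot φ X (t • w) - t ^ 2 • gQuad φ X w
    rw [slice, gCubic, h.gQuad_smul, smul_eq_mul]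

/-- Hence `G₃ = rem G 2`: the printed `G₃` is the remainder of `G` after its quadratic part, in the vocabulary of
`B13ExpansionOrder` (as `D̃₃ = rem D̃ 2` there). [cite: Balaban1987RG1, (2.5) p.266] -/
theorem gCubic_eq_rem [CompleteSpace V] [Fintype ι] (h : Chart φ X Rφ Mφ RX MX) : gCubic φ X = rem (gTot φ X) 2 := by
  funext w
  rw [rem, h.homPart_gTot_two, gCubic]

end Chart

/-! ## §5. *«localized in blocks of the lattice»* -/

/-- **Blockwise localisation**: if the block variable `X_i` factors through a (restriction) map `π : E →L E′` — `X_i = Y ∘ π` with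
`Y` differentiable at `0` — then the `i`-th term of `G₃` depends on `B′` only through `πB′` (its linear part factors too, by the
chain rule).  This is the typed content of *«localized in blocks»*: which `π` (restriction to the bonds of the block `B(y)`) is
the dictionary. [cite: Balaban1987RG1, (2.5) p.266] -/
theorem gCubicTerm_local {E' : Type*} [NormedAddCommGroup E'] [NormedSpace ℂ E'] (φ : V → ℂ) (X : ι → E → V) (i : ι)
    (π : E →L[ℂ] E') (Y : E' → V) (hY : DifferentiableAt ℂ Y 0) (hfac : ∀ B, X i B = Y (π B)) {B B' : E}
    (hπ : π B = π B') : gCubicTerm φ X i B = gCubicTerm φ X i B' := by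
  have hXf : X i = Y ∘ π := funext hfac
  have hlin : linPart X i = (fderiv ℂ Y 0).comp π := by
    rw [linPart, hXf, fderiv_comp 0 (by rwa [map_zero]) π.differentiableAt, π.fderiv, map_zero]
  simp only [gCubicTerm, hfac, hlin, ContinuousLinearMap.comp_apply, hπ]

/-! ## §6. The T4 edge of the (2.12)-census, with the `G₃`-hypotheses DISCHARGED -/

/-- **T4 of (2.12), `−(1/g_k²)G₃(g_kB)`, from the chart structure**: on the domain `g_k|B| < ε₁` (`3ε₁ ≤ RX`), `g⁻²G₃(gB)` is the
quadratic form `⟨Qop(B)B, B⟩` of an operator with `‖Qop(B)‖ ≤ ½·27·cubicConst·ε₁`, UNIFORMLY in `g ≠ 0` — i.e.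
`B13PkScaling.quadraticForm_of_scaled_cubic` with its three `G₃`-inputs (analyticity, cubic bound, radius) supplied by §3–§4
instead of being taken from the print. [cite: Balaban1987RG1, (2.12) p.268] -/
theorem quadraticForm_scaled_gCubic [CompleteSpace E] [CompleteSpace V] [Fintype ι] [Nonempty ι] (h : Chart φ X Rφ Mφ RX MX) {g : ℂ} (hg : g ≠ 0)
    {ε₁ : ℝ} (h3 : 3 * ε₁ ≤ RX) {B : E} (hB : ‖g‖ * ‖B‖ < ε₁) :
    scaled g (gCubic φ X) B = Qop (scaled g (gCubic φ X)) B B B ∧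
      ‖Qop (scaled g (gCubic φ X)) B‖ ≤ 1 / 2 * (27 * cubicConst Rφ Mφ RX MX (Fintype.card ι) * ε₁) :=
  quadraticForm_of_scaled_cubic hg h.cubicConst_nonneg h.RX_pos h.analyticOnNhd_gCubic (fun _ hz => h.norm_gCubic_le hz) h3 hB

/-! ## §7. Non-vacuity -/

/-- The hypothesis set `Chart` is inhabited (so no theorem above is vacuous): `E = V = ℂ`, one block, `φ(v) = v²`
(analytic, `φ(0) = 0`, `Dφ(0) = 0`), `X(B) = B/2`, radii `Rφ = 2`, `RX = 1`, bounds `Mφ = 4`, `MX = 1`. [folklore] -/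
theorem chart_witness : Chart (ι := Unit) (fun v : ℂ => v ^ 2) (fun _ B => (2 : ℂ)⁻¹ * B) 2 4 1 1 := by
  refine ⟨by norm_num, by norm_num, ?_, ?_, by simp, ?_, ?_, ?_, by simp, by norm_num⟩
  · exact fun v _ => (analyticAt_id.pow 2)
  · intro v hv
    rw [mem_ball_zero_iff] at hv; rw [norm_pow]; nlinarith [norm_nonneg v]
  · have : HasFDerivAt (fun v : ℂ => v ^ 2) (0 : ℂ →L[ℂ] ℂ) 0 := by simpa using (hasFDerivAt_id (𝕜 := ℂ) (0 : ℂ)).pow 2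
    exact this.fderiv
  · exact fun _ B _ => (analyticAt_const.mul analyticAt_id)
  · intro _ B hB
    rw [mem_ball_zero_iff] at hB; rw [norm_mul, norm_inv, Complex.norm_ofNat]; linarith [norm_nonneg B]

end

end Summit.QuantumFields.BalabanUV.Beta.GaugeFixingCubic266
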